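import Summits.BirchSwinnertonDyer.BirchSwinnertonDyer.Theorems.ManinLocalTwoThreeShimuraRationalThreeIsogeny
import Summits.BirchSwinnertonDyer.BirchSwinnertonDyer.Theorems.ManinLocalTwoThreeHalfLatticeVelu
import Summits.BirchSwinnertonDyer.Rank1Residual.ManinAdditive.ShimuraLedger
import HarnessLib

/-!
# The Shimura trichotomy at `4 ∣ N` for ANY globally minimal model: index `2` gives a rational root of `Ψ₂Sq`;
# at `N = 4p` an optimal curve with `E₀(ℚ)[2] = 0` IS Stevens' curve — without the shape hypothesis `a₁ = a₃ = 0`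

Summit `BirchSwinnertonDyer`, route `ManinLocalTwoThree` (cell bsd-f2-manin), deciding crux C2 `ManinOddAtFour`
(stmt-BirchSwinnertonDyer-22967).  `…ShimuraRationalTwoTorsion` (p635211) proved the trichotomy `Λ₁(f) = Λ₀(f)` ∨
`Λ₁(f) = 2Λ₀(f)` ∨ `HasRationalTwoTorsion W₀` for models `W₀ = [0, a₂, 0, a₄, a₆]` (via the cubic `x³ + a₂x² + a₄x + a₆`).  A
globally minimal model need not have that shape (`a₁, a₃` odd); here the same statement for ANY model, with the rational
`2`-torsion point read off Mathlib's `2`-division polynomial `W₀.Ψ₂Sq = 4x³ + b₂x² + 2b₄x + b₆` (the method of the `3`-adic twin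
`…ShimuraRationalThreeIsogeny`, p637503: `ΨSq₂(℘(z₀)) = 0 ⟺ 2z₀ ∈ Λ`, `PeriodPair.eval_ΨSq_weierstrassP_eq_zero_iff`, and the
covariance `Ψ₂Sq^{W}(x − b₂/12) = Ψ₂Sq^{W_sh}(x)`):

* `exists_Ψ₂Sq_root_of_index_two` — an index-`2` superlattice of the Néron lattice with rational invariants yields a rational
  root of `W₀.Ψ₂Sq` (a rational `2`-torsion point `(x, −(a₁x + a₃)/2)`), any model;
* `hasRationalTwoTorsion_iff_exists_Ψ₂Sq_root` — for `W = [0, a₂, 0, a₄, a₆]` the two notions agree (`Ψ₂Sq = 4·cubic`);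
* `trichotomy_shimura_of_four_dvd_level_anyModel` — `Λ₁(f) = Λ₀(f)` ∨ `Λ₁(f) = 2Λ₀(f)` ∨ `∃ x : ℚ, W₀.Ψ₂Sq(x) = 0`;
* `stevens_eq_optimal_of_no_Ψ₂Sq_root_four_mul[_prime]` — **at `N = 4q` / `4p`: `W₀.Ψ₂Sq` without rational root (`E₀(ℚ)[2] = 0`)
  ⟹ `Λ₁(f) = Λ₀(f)` and `|c₀| = |c₁|`**, for every globally minimal `W₀`; whence `2 ∤ c₀ ⟺ 2 ∤ c₁` there.

HONEST FRAMING: structure only; C2, Manin's conjecture and BSD are not proved.  No definitions.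
-/

set_option autoImplicit false
-- the summit-side namespace `Summit.BirchSwinnertonDyer.BirchSwinnertonDyer.…` is the tree's (summit = sub-problem)
set_option linter.dupNamespace false

noncomputable section

open WeierstrassCurve Literature.NumberTheory.EllipticCurves Literature.NumberTheory.EllipticCurves.ModularForms
open CongruenceSubgroup Polynomial
open Summit.BirchSwinnertonDyer.Rank1Residual.ManinAdditive.ShimuraLedger

namespace Summit.BirchSwinnertonDyer.BirchSwinnertonDyer.Theorems.ManinLocalTwoThree

variable {W₁ W₀ : WeierstrassCurve ℚ} [W₁.IsElliptic] [W₁.IsGloballyMinimal] [W₀.IsElliptic]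
  [W₀.IsGloballyMinimal] {N : ℕ} [NeZero N]

/-! ### From an index-`2` superlattice to a rational root of `Ψ₂Sq` (any model) -/

/-- **Covariance of `Ψ₂Sq` under completing the square and the cube** (`u = 1`, `r = −b₂/12`): for any model `W/ℚ`,
`Ψ₂Sq^{W}(x − b₂/12) = Ψ₂Sq^{W_sh}(x)` with `W_sh = [0, 0, 0, −c₄/48, −c₆/864]` — a polynomial identity. -/
theorem Ψ₂Sq_eval_sub_b₂_div_twelve (W : WeierstrassCurve ℚ) (x : ℚ) :
    W.Ψ₂Sq.eval (x - W.b₂ / 12) = (⟨0, 0, 0, -W.c₄ / 48, -W.c₆ / 864⟩ : WeierstrassCurve ℚ).Ψ₂Sq.eval x := by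
  simp only [WeierstrassCurve.Ψ₂Sq, WeierstrassCurve.b₂, WeierstrassCurve.b₄, WeierstrassCurve.b₆,
    WeierstrassCurve.c₄, WeierstrassCurve.c₆, eval_add, eval_mul, eval_pow, eval_C, eval_X]
  ring

omit [W₀.IsElliptic] [W₀.IsGloballyMinimal] in
/-- **An index-`2` superlattice with rational invariants yields a rational `2`-torsion point — any model.**  `W₀/ℚ` with
Néron-type pair `L₀` (`g₂ = c₄/12`, `g₃ = c₆/216`); `L'` a period pair with rational `g₂, g₃`, `Λ₀ ⊆ Λ' ⊆ Λ₀ ∪ (z₀ + Λ₀)`,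
`z₀ ∈ Λ' ∖ Λ₀`, `2z₀ ∈ Λ₀`: then `℘_{Λ₀}(z₀) ∈ ℚ` (p632972) is a root of `Ψ₂Sq` of `E_{Λ₀}`, so `℘_{Λ₀}(z₀) − b₂/12` is a rational
root of `W₀.Ψ₂Sq`. -/
theorem exists_Ψ₂Sq_root_of_index_two {L₀ : PeriodPair} (hL₀ : IsNeronLatticeOf (W₀.baseChange ℂ) L₀) (L' : PeriodPair)
    (h₂' : ∃ r : ℚ, (r : ℂ) = L'.g₂) (h₃' : ∃ r : ℚ, (r : ℂ) = L'.g₃) (hle : L₀.lattice ≤ L'.lattice)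
    {z₀ : ℂ} (hz₀' : z₀ ∈ L'.lattice) (hz₀ : z₀ ∉ L₀.lattice) (h2 : 2 * z₀ ∈ L₀.lattice)
    (hidx : ∀ w ∈ L'.lattice, w ∈ L₀.lattice ∨ w - z₀ ∈ L₀.lattice) :
    ∃ x : ℚ, W₀.Ψ₂Sq.eval x = 0 := by
  have hc₄ : (W₀.baseChange ℂ).c₄ = (W₀.c₄ : ℂ) := by simp [WeierstrassCurve.baseChange, WeierstrassCurve.map_c₄]
  have hc₆ : (W₀.baseChange ℂ).c₆ = (W₀.c₆ : ℂ) := by simp [WeierstrassCurve.baseChange, WeierstrassCurve.map_c₆]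
  have hg₂ : L₀.g₂ = ((W₀.c₄ / 12 : ℚ) : ℂ) := by rw [hL₀.1, hc₄]; push_cast; ring
  have hg₃ : L₀.g₃ = ((W₀.c₆ / 216 : ℚ) : ℂ) := by rw [hL₀.2, hc₆]; push_cast; ring
  obtain ⟨q, hq⟩ := L₀.exists_ratCast_eq_weierstrassP_of_index_two L' hle ⟨_, hg₂.symm⟩ ⟨_, hg₃.symm⟩
    h₂' h₃' hz₀' hz₀ hidx
  have hΨsq : (L₀.curve.ΨSq 2).eval (L₀.weierstrassP z₀) = 0 :=
    (L₀.eval_ΨSq_weierstrassP_eq_zero_iff hz₀ 2).mpr (by exact_mod_cast h2)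
  set E : WeierstrassCurve ℚ := ⟨0, 0, 0, -W₀.c₄ / 48, -W₀.c₆ / 864⟩ with hE
  have hEmap : E.map (algebraMap ℚ ℂ) = L₀.curve := by
    refine PeriodPair.map_eq_curve ?_ ?_
    · rw [hg₂, eq_ratCast]; push_cast; ring
    · rw [hg₃, eq_ratCast]; push_cast; ring
  have hEΨ : aeval (L₀.weierstrassP z₀) (E.ΨSq 2) = 0 := by
    rw [PeriodPair.aeval_ΨSq_of_map_eq_curve hEmap]; exact hΨsq
  rw [WeierstrassCurve.ΨSq_two, ← hq] at hEΨ
  have hq' : (q : ℂ) = algebraMap ℚ ℂ q := (eq_ratCast _ q).symm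
  rw [hq', aeval_algebraMap_apply_eq_algebraMap_eval] at hEΨ
  have hroot : E.Ψ₂Sq.eval q = 0 := by
    have h := hEΨ
    rw [eq_ratCast] at h
    exact_mod_cast h
  exact ⟨q - W₀.b₂ / 12, by rw [Ψ₂Sq_eval_sub_b₂_div_twelve, ← hE]; exact hroot⟩

/-- For `W = [0, a₂, 0, a₄, a₆]`: `HasRationalTwoTorsion W ⟺ W.Ψ₂Sq` has a rational root (`Ψ₂Sq = 4(x³ + a₂x² + a₄x + a₆)`). -/
theorem hasRationalTwoTorsion_iff_exists_Ψ₂Sq_root (W : WeierstrassCurve ℚ) (ha₁ : W.a₁ = 0) (ha₃ : W.a₃ = 0) :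
    HasRationalTwoTorsion W ↔ ∃ x : ℚ, W.Ψ₂Sq.eval x = 0 := by
  have key : ∀ x : ℚ, W.Ψ₂Sq.eval x = 4 * (x ^ 3 + W.a₂ * x ^ 2 + W.a₄ * x + W.a₆) := fun x ↦ by
    simp only [WeierstrassCurve.Ψ₂Sq, WeierstrassCurve.b₂, WeierstrassCurve.b₄, WeierstrassCurve.b₆, ha₁, ha₃,
      eval_add, eval_mul, eval_pow, eval_C, eval_X]
    ring
  refine ⟨fun ⟨e, he⟩ ↦ ⟨e, by rw [key, he, mul_zero]⟩, fun ⟨x, hx⟩ ↦ ⟨x, ?_⟩⟩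
  have h := key x
  rw [hx] at h
  linarith [h]

/-! ### The Shimura trichotomy at `4 ∣ N`, any model -/

/-- **Shimura trichotomy for the optimal pair at `4 ∣ N`, ANY globally minimal model.**  For the optimal
`X₁(N)`-datum `D₁` and the optimal `X₀(N)`-datum `D₀` of a class: `Λ₁(f) = Λ₀(f)`, or `Λ₁(f) = 2Λ₀(f)`, or `W₀.Ψ₂Sq` has a
rational root (a rational `2`-torsion point).  (Proof verbatim from `trichotomy_shimura_of_four_dvd_level`, p635211, with
`exists_Ψ₂Sq_root_of_index_two` in place of the cubic.) -/
theorem trichotomy_shimura_of_four_dvd_level_anyModel (D₁ : Gamma1ParametrizationData W₁ N)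
    (D₀ : ModularParametrizationData W₀ N) (hiso : IsIsogenous W₁ W₀) (h₁ : D₁.IsOptimal)
    (h₀ : ∀ z ∈ D₀.L.lattice, ∃ w ∈ periodLattice D₀.f, z = D₀.c * w) (h4 : 2 ^ 2 ∣ N) :
    periodLatticeGamma1 D₀.f = periodLattice D₀.f ∨
      (∀ z : ℂ, z ∈ periodLatticeGamma1 D₀.f ↔ ∃ w ∈ periodLattice D₀.f, z = 2 * w) ∨
      ∃ x : ℚ, W₀.Ψ₂Sq.eval x = 0 := by
  have hf : D₁.f = D₀.f := D₁.f_eq_of_isIsogenous D₀ hiso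
  have hc₁ : (D₁.c : ℂ) ≠ 0 := by exact_mod_cast D₁.maninConstant_ne_zero
  have hc₀ : (D₀.c : ℂ) ≠ 0 := by exact_mod_cast D₀.maninConstant_ne_zero_holds
  have hc₄W₁ : (W₁.baseChange ℂ).c₄ = (W₁.c₄ : ℂ) := by simp [WeierstrassCurve.baseChange, WeierstrassCurve.map_c₄]
  have hc₆W₁ : (W₁.baseChange ℂ).c₆ = (W₁.c₆ : ℂ) := by simp [WeierstrassCurve.baseChange, WeierstrassCurve.map_c₆]
  have hg₂₁ : ∃ r : ℚ, (r : ℂ) = D₁.L.g₂ := ⟨W₁.c₄ / 12, by rw [D₁.isNeronLattice.1, hc₄W₁]; push_cast; ring⟩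
  have hg₃₁ : ∃ r : ℚ, (r : ℂ) = D₁.L.g₃ := ⟨W₁.c₆ / 216, by rw [D₁.isNeronLattice.2, hc₆W₁]; push_cast; ring⟩
  -- Ling–Oesterlé at `2`
  have h2Λ : ∀ w ∈ periodLattice D₀.f, (2 : ℂ) * w ∈ periodLatticeGamma1 D₀.f := fun w hw ↦ by
    have h := pMulLatticeLeGamma1OfTracelessPrime_holds N D₀.f D₀.isNewformOf.1 2 Nat.prime_two
      ((dvd_pow_self 2 two_ne_zero).trans h4) (D₀.isNewformOf.1.cuspCoeff_eq_zero_of_sq_dvd Nat.prime_two h4) w hw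
    exact_mod_cast h
  -- the index-1 and index-4 outputs, from lattice data
  have out1 : (∀ w ∈ periodLattice D₀.f, w ∈ periodLatticeGamma1 D₀.f) →
      periodLatticeGamma1 D₀.f = periodLattice D₀.f :=
    fun h ↦ le_antisymm (periodLatticeGamma1_le_periodLattice D₀.f) h
  have out4 : (∀ z ∈ periodLatticeGamma1 D₀.f, ∃ w ∈ periodLattice D₀.f, z = 2 * w) →
      ∀ z : ℂ, z ∈ periodLatticeGamma1 D₀.f ↔ ∃ w ∈ periodLattice D₀.f, z = 2 * w :=
    fun h z ↦ ⟨h z, by rintro ⟨w, hw, rfl⟩; exact h2Λ w hw⟩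
  -- the ledger: `c₀ = ε c₁` or `c₀ = ε · 2c₁`
  rcases natAbs_maninConstant₀_eq_or_eq_two_mul_of_four_dvd_level D₁ D₀ hiso h₁ h₀ h4 with habs | habs
  · -- undoubled: `Λ_{E₁} ⊆ Λ_{E₀} ⊆ ½Λ_{E₁}`; trichotomy on `(Λ_{E₀}, ½Λ_{E₁})`
    obtain ⟨ε, hε, hcc⟩ : ∃ ε : ℂ, (ε = 1 ∨ ε = -1) ∧ (D₀.c : ℂ) = ε * D₁.c := by
      rcases Int.natAbs_eq_natAbs_iff.mp habs with h' | h'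
      · exact ⟨1, Or.inl rfl, by rw [one_mul]; exact_mod_cast h'⟩
      · exact ⟨-1, Or.inr rfl, by rw [neg_one_mul]; exact_mod_cast h'⟩
    have hε2 : ε * ε = 1 := by rcases hε with rfl | rfl <;> norm_num
    have hεmem : ∀ (S : AddSubgroup ℂ) (w : ℂ), w ∈ S → ε * w ∈ S := by
      intro S w hw; rcases hε with rfl | rfl
      · rwa [one_mul]
      · rw [neg_one_mul]; exact neg_mem hw
    set H : PeriodPair := D₁.L.mulLeft ((2 : ℂ)⁻¹) (inv_ne_zero two_ne_zero) with hH
    have hHmem : ∀ z, z ∈ H.lattice ↔ 2 * z ∈ D₁.L.lattice := fun z ↦ by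
      rw [hH, PeriodPair.mem_mulLeft_lattice, inv_inv]
    have hle : D₀.L.lattice ≤ H.lattice := by
      intro z hz
      obtain ⟨w, hw, rfl⟩ := h₀ z hz
      rw [hHmem]
      have e : 2 * ((D₀.c : ℂ) * w) = (D₁.c : ℂ) * (ε * (2 * w)) := by rw [hcc]; ring
      rw [e]
      exact D₁.smul_periodLatticeGamma1_le _ (hεmem _ _ (by rw [hf]; exact h2Λ w hw))
    have htwo : ∀ w ∈ H.lattice, 2 * w ∈ D₀.L.lattice := by
      intro w hw
      rw [hHmem] at hw
      obtain ⟨w₁, hw₁, hw₁'⟩ := h₁ _ hw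
      have hw₀ : ε * w₁ ∈ periodLattice D₀.f := hεmem _ _ (hf ▸ periodLatticeGamma1_le_periodLattice D₁.f hw₁)
      have e : 2 * w = (D₀.c : ℂ) * (ε * w₁) := by
        rw [hw₁', hcc]; linear_combination -((D₁.c : ℂ) * w₁) * hε2
      rw [e]; exact D₀.smul_periodLattice_le _ hw₀
    rcases halfLattice_trichotomy D₀.L H hle htwo with hcase | hcase | hcase
    · -- `½Λ_{E₁} ⊆ Λ_{E₀}`: `Λ₁ ⊆ 2Λ₀`, index 4
      right; left
      refine out4 fun z hz ↦ ?_
      have hzH : (D₁.c : ℂ) * z * 2⁻¹ ∈ H.lattice := by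
        rw [hHmem, show 2 * ((D₁.c : ℂ) * z * 2⁻¹) = (D₁.c : ℂ) * z by ring]
        exact D₁.smul_periodLatticeGamma1_le z (hf ▸ hz)
      obtain ⟨w, hw, hw'⟩ := h₀ _ (hcase _ hzH)
      refine ⟨ε * w, hεmem _ _ hw, ?_⟩
      have h : (D₁.c : ℂ) * z = (D₁.c : ℂ) * (2 * (ε * w)) := by
        rw [show (D₁.c : ℂ) * z = 2 * ((D₁.c : ℂ) * z * 2⁻¹) by ring, hw', hcc]; ring
      exact mul_left_cancel₀ hc₁ h
    · -- `½Λ_{E₀} ⊆ ½Λ_{E₁}`: `Λ₀ ⊆ Λ₁`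
      left
      refine out1 fun w hw ↦ ?_
      have h2h : 2 * ((D₀.c : ℂ) * w * 2⁻¹) ∈ D₀.L.lattice := by
        rw [show 2 * ((D₀.c : ℂ) * w * 2⁻¹) = (D₀.c : ℂ) * w by ring]; exact D₀.smul_periodLattice_le w hw
      have hH' := hcase _ h2h
      rw [hHmem, show 2 * ((D₀.c : ℂ) * w * 2⁻¹) = (D₀.c : ℂ) * w by ring] at hH'
      obtain ⟨w₁, hw₁, hw₁'⟩ := h₁ _ hH'
      have hw' : w = ε * w₁ := by
        have h : (D₁.c : ℂ) * w = (D₁.c : ℂ) * (ε * w₁) := by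
          rw [hcc] at hw₁'
          linear_combination ε * hw₁' - ((D₁.c : ℂ) * w) * hε2
        exact mul_left_cancel₀ hc₁ h
      rw [hw', ← hf]; exact hεmem _ _ hw₁
    · -- index 2: rational half-period of `Λ_{E₀}`
      right; right
      obtain ⟨z₀, hz₀', hz₀, hidx⟩ := hcase
      refine exists_Ψ₂Sq_root_of_index_two D₀.isNeronLattice H ?_ ?_ hle hz₀' hz₀ (htwo z₀ hz₀') hidx
      · obtain ⟨r, hr⟩ := hg₂₁
        exact ⟨2 ^ 4 * r, by rw [hH, PeriodPair.g₂_mulLeft, ← hr]; push_cast; ring⟩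
      · obtain ⟨r, hr⟩ := hg₃₁
        exact ⟨2 ^ 6 * r, by rw [hH, PeriodPair.g₃_mulLeft, ← hr]; push_cast; ring⟩
  · -- doubled: `Λ_{E₀} ⊆ Λ_{E₁} ⊆ ½Λ_{E₀}`; trichotomy on `(Λ_{E₀}, Λ_{E₁})`
    obtain ⟨ε, hε, hcc⟩ : ∃ ε : ℂ, (ε = 1 ∨ ε = -1) ∧ (D₀.c : ℂ) = ε * (2 * D₁.c) := by
      have h : D₀.maninConstant.natAbs = (2 * D₁.maninConstant).natAbs := by rw [habs, Int.natAbs_mul]; rfl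
      rcases Int.natAbs_eq_natAbs_iff.mp h with h' | h'
      · exact ⟨1, Or.inl rfl, by rw [one_mul]; exact_mod_cast h'⟩
      · exact ⟨-1, Or.inr rfl, by rw [neg_one_mul]; exact_mod_cast h'⟩
    have hε2 : ε * ε = 1 := by rcases hε with rfl | rfl <;> norm_num
    have hεmem : ∀ (S : AddSubgroup ℂ) (w : ℂ), w ∈ S → ε * w ∈ S := by
      intro S w hw; rcases hε with rfl | rfl
      · rwa [one_mul]
      · rw [neg_one_mul]; exact neg_mem hw
    have hle : D₀.L.lattice ≤ D₁.L.lattice := by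
      intro z hz
      obtain ⟨w, hw, rfl⟩ := h₀ z hz
      have e : (D₀.c : ℂ) * w = (D₁.c : ℂ) * (ε * (2 * w)) := by rw [hcc]; ring
      rw [e]
      exact D₁.smul_periodLatticeGamma1_le _ (hεmem _ _ (by rw [hf]; exact h2Λ w hw))
    have htwo : ∀ w ∈ D₁.L.lattice, 2 * w ∈ D₀.L.lattice := by
      intro w hw
      obtain ⟨w₁, hw₁, rfl⟩ := h₁ w hw
      have hw₀ : ε * w₁ ∈ periodLattice D₀.f := hεmem _ _ (hf ▸ periodLatticeGamma1_le_periodLattice D₁.f hw₁)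
      have e : 2 * ((D₁.c : ℂ) * w₁) = (D₀.c : ℂ) * (ε * w₁) := by
        rw [hcc]; linear_combination -(2 * (D₁.c : ℂ) * w₁) * hε2
      rw [e]; exact D₀.smul_periodLattice_le _ hw₀
    rcases halfLattice_trichotomy D₀.L D₁.L hle htwo with hcase | hcase | hcase
    · -- `Λ_{E₁} = Λ_{E₀}`: index 4
      right; left
      refine out4 fun z hz ↦ ?_
      have hz' : (D₁.c : ℂ) * z ∈ D₀.L.lattice := hcase _ (D₁.smul_periodLatticeGamma1_le z (hf ▸ hz))
      obtain ⟨w, hw, hw'⟩ := h₀ _ hz'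
      refine ⟨ε * w, hεmem _ _ hw, ?_⟩
      have h : (D₁.c : ℂ) * z = (D₁.c : ℂ) * (2 * (ε * w)) := by rw [hw', hcc]; ring
      exact mul_left_cancel₀ hc₁ h
    · -- `Λ_{E₁} ⊇ ½Λ_{E₀}`: `Λ₁ = Λ₀`
      left
      refine out1 fun w hw ↦ ?_
      have h2h : 2 * (ε * ((D₁.c : ℂ) * w)) ∈ D₀.L.lattice := by
        have e : 2 * (ε * ((D₁.c : ℂ) * w)) = (D₀.c : ℂ) * w := by rw [hcc]; ring
        rw [e]; exact D₀.smul_periodLattice_le w hw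
      obtain ⟨w₁, hw₁, hw₁'⟩ := h₁ _ (hcase _ h2h)
      have hw' : w = ε * w₁ := by
        have h : (D₁.c : ℂ) * w = (D₁.c : ℂ) * (ε * w₁) := by
          linear_combination ε * hw₁' - ((D₁.c : ℂ) * w) * hε2
        exact mul_left_cancel₀ hc₁ h
      rw [hw', ← hf]; exact hεmem _ _ hw₁
    · -- index 2: rational half-period of `Λ_{E₀}`
      right; right
      obtain ⟨z₀, hz₀', hz₀, hidx⟩ := hcase
      exact exists_Ψ₂Sq_root_of_index_two D₀.isNeronLattice D₁.L hg₂₁ hg₃₁ hle hz₀' hz₀ (htwo z₀ hz₀') hidx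


/-- **At `N = 4q` (`q` odd, `(ℤ/q)ˣ` cyclic), ANY globally minimal `W₀`: `W₀.Ψ₂Sq` without rational root (`E₀(ℚ)[2] = 0`)
⟹ `Λ₁(f) = Λ₀(f)` and `|c₀| = |c₁|`** (index `4` is impossible there, p632017). -/
theorem stevens_eq_optimal_of_no_Ψ₂Sq_root_four_mul {q : ℕ} (hq : Odd q) [IsCyclic (ZMod q)ˣ] [NeZero (4 * q)]
    (D₁ : Gamma1ParametrizationData W₁ (4 * q)) (D₀ : ModularParametrizationData W₀ (4 * q))
    (hiso : IsIsogenous W₁ W₀) (h₁ : D₁.IsOptimal)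
    (h₀ : ∀ z ∈ D₀.L.lattice, ∃ w ∈ periodLattice D₀.f, z = D₀.c * w) (hno : ∀ x : ℚ, W₀.Ψ₂Sq.eval x ≠ 0) :
    periodLatticeGamma1 D₀.f = periodLattice D₀.f ∧ D₀.maninConstant.natAbs = D₁.maninConstant.natAbs := by
  have hf : D₁.f = D₀.f := D₁.f_eq_of_isIsogenous D₀ hiso
  rcases trichotomy_shimura_of_four_dvd_level_anyModel D₁ D₀ hiso h₁ h₀ ⟨q, rfl⟩ with h | h | ⟨x, hx⟩
  · exact ⟨h, natAbs_maninConstant₀_eq_of_periodLatticeGamma1_eq_periodLattice D₁ D₀ h₁ h₀ hf h⟩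
  · exact absurd h (not_periodLatticeGamma1_eq_two_mul_of_four_mul hq D₀ h₀)
  · exact absurd hx (hno x)

/-- **At `N = 4p`, `p` an odd prime, ANY globally minimal `W₀`**: no rational `2`-torsion ⟹ `Λ₁(f) = Λ₀(f)`, `|c₀| = |c₁|`. -/
theorem stevens_eq_optimal_of_no_Ψ₂Sq_root_four_mul_prime {p : ℕ} (hp : p.Prime) (hp2 : p ≠ 2) [NeZero (4 * p)]
    (D₁ : Gamma1ParametrizationData W₁ (4 * p)) (D₀ : ModularParametrizationData W₀ (4 * p))
    (hiso : IsIsogenous W₁ W₀) (h₁ : D₁.IsOptimal)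
    (h₀ : ∀ z ∈ D₀.L.lattice, ∃ w ∈ periodLattice D₀.f, z = D₀.c * w) (hno : ∀ x : ℚ, W₀.Ψ₂Sq.eval x ≠ 0) :
    periodLatticeGamma1 D₀.f = periodLattice D₀.f ∧ D₀.maninConstant.natAbs = D₁.maninConstant.natAbs := by
  haveI : IsCyclic (ZMod p)ˣ := ZMod.isCyclic_units_prime hp
  exact stevens_eq_optimal_of_no_Ψ₂Sq_root_four_mul (hp.odd_of_ne_two hp2) D₁ D₀ hiso h₁ h₀ hno

/-- **DICHOTOMY at `N = 4p`, any model**: `Λ₁(f) = Λ₀(f) ∧ |c₀| = |c₁|`, or `W₀.Ψ₂Sq` has a rational root. -/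
theorem periodLatticeGamma1_eq_or_exists_Ψ₂Sq_root_of_four_mul_prime {p : ℕ} (hp : p.Prime) (hp2 : p ≠ 2)
    [NeZero (4 * p)] (D₁ : Gamma1ParametrizationData W₁ (4 * p)) (D₀ : ModularParametrizationData W₀ (4 * p))
    (hiso : IsIsogenous W₁ W₀) (h₁ : D₁.IsOptimal)
    (h₀ : ∀ z ∈ D₀.L.lattice, ∃ w ∈ periodLattice D₀.f, z = D₀.c * w) :
    (periodLatticeGamma1 D₀.f = periodLattice D₀.f ∧ D₀.maninConstant.natAbs = D₁.maninConstant.natAbs) ∨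
      ∃ x : ℚ, W₀.Ψ₂Sq.eval x = 0 := by
  by_cases hno : ∃ x : ℚ, W₀.Ψ₂Sq.eval x = 0
  · exact Or.inr hno
  · exact Or.inl (stevens_eq_optimal_of_no_Ψ₂Sq_root_four_mul_prime hp hp2 D₁ D₀ hiso h₁ h₀
      fun x hx ↦ hno ⟨x, hx⟩)

/-- **C2 on the optimal curve ⟺ C2 for Stevens' datum, at `N = 4p` without rational `2`-torsion, ANY model**:
`2 ∤ c₀ ⟺ 2 ∤ c₁`. -/
theorem not_two_dvd_maninConstant₀_iff_of_no_Ψ₂Sq_root_four_mul_prime {p : ℕ} (hp : p.Prime) (hp2 : p ≠ 2)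
    [NeZero (4 * p)] (D₁ : Gamma1ParametrizationData W₁ (4 * p)) (D₀ : ModularParametrizationData W₀ (4 * p))
    (hiso : IsIsogenous W₁ W₀) (h₁ : D₁.IsOptimal)
    (h₀ : ∀ z ∈ D₀.L.lattice, ∃ w ∈ periodLattice D₀.f, z = D₀.c * w) (hno : ∀ x : ℚ, W₀.Ψ₂Sq.eval x ≠ 0) :
    ¬ (2 : ℤ) ∣ D₀.maninConstant ↔ ¬ (2 : ℤ) ∣ D₁.maninConstant := by
  have heq := (stevens_eq_optimal_of_no_Ψ₂Sq_root_four_mul_prime hp hp2 D₁ D₀ hiso h₁ h₀ hno).2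
  rw [← Int.natAbs_dvd_natAbs, ← Int.natAbs_dvd_natAbs (b := D₁.maninConstant), heq]

/-- Divisor form, any model: at `N = 4p` without rational `2`-torsion, `ℓ ∣ c₀ ⟺ ℓ ∣ c₁` for every integer `ℓ`. -/
theorem dvd_maninConstant₀_iff_of_no_Ψ₂Sq_root_four_mul_prime {p : ℕ} (hp : p.Prime) (hp2 : p ≠ 2)
    [NeZero (4 * p)] (D₁ : Gamma1ParametrizationData W₁ (4 * p)) (D₀ : ModularParametrizationData W₀ (4 * p))
    (hiso : IsIsogenous W₁ W₀) (h₁ : D₁.IsOptimal)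
    (h₀ : ∀ z ∈ D₀.L.lattice, ∃ w ∈ periodLattice D₀.f, z = D₀.c * w) (hno : ∀ x : ℚ, W₀.Ψ₂Sq.eval x ≠ 0)
    (ℓ : ℤ) : ℓ ∣ D₀.maninConstant ↔ ℓ ∣ D₁.maninConstant := by
  have heq := (stevens_eq_optimal_of_no_Ψ₂Sq_root_four_mul_prime hp hp2 D₁ D₀ hiso h₁ h₀ hno).2
  rw [← Int.natAbs_dvd_natAbs, ← Int.natAbs_dvd_natAbs (b := D₁.maninConstant), heq]

end Summit.BirchSwinnertonDyer.BirchSwinnertonDyer.Theorems.ManinLocalTwoThree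

end
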